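import Mathlib
import Literature.Analysis.FluidPDE.Tao2016AveragedNS.RenormalisedCascadeWaves
import Literature.Analysis.FluidPDE.Tao2016AveragedNS.SelfSimilarCascadeBlowup
import Literature.Analysis.FluidPDE.Tao2016AveragedNS.ViscousEternalSolutions
import Literature.Analysis.FluidPDE.Tao2016AveragedNS.BoundedEternalSolutions
import Summits.NavierStokesRegularity.NavierStokesRegularity.Theses.TaoLadderRungTwoBreak
import Summits.NavierStokesRegularity.NavierStokesRegularity.Theorems.TaoLadderRungTwoBreakNoSurvivingEternalViscBddOneLinks
import Summits.NavierStokesRegularity.NavierStokesRegularity.Theorems.TaoLadderRungTwoBreakNoSurvivingEternalViscBddOneWakeDyadicClassical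
import Summits.NavierStokesRegularity.NavierStokesRegularity.Theorems.TaoLadderRungTwoBreakNoSurvivingEternalViscBddOneWakeDyadicViscousClassical
import Summits.NavierStokesRegularity.NavierStokesRegularity.Theorems.WakeRatchetAdmissibleEternalBoundCritical
import Summits.NavierStokesRegularity.NavierStokesRegularity.Theorems.WakeRatchetAdmissibleEternalBoundDyadic
import Summits.NavierStokesRegularity.NavierStokesRegularity.Theorems.WakeRatchetTailRatchet.Negative.TailRatchetFalseOfDyadicScalarFronts

/-!
# Crux `TaoLadderRungTwoBreak.NoSurvivingEternalViscBddOne` (stmt-NavierStokesRegularity-20419):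
# the viscous dyadic slice (ρ+) is EXACTLY «no loud TYPE-I ancient solution of the viscous Katz–Pavlović chain»

MODEL lattice ODEs only (Tao 2016 §1.2, §4, §6.4); nothing in this file is a statement about the
Navier–Stokes equations, and no stub, crux, rung or summit is proved by it.

Companion of `…WakeDyadicViscousClassical` (classical form ⇒ (ρ+) on the dyadic member).  Here the CONVERSE
embedding: a real solution `V` of

  `V̇_n = Λ V_{n-1}² − Λ⁻¹ V_n V_{n+1} − ν̂ (1+ε₀)^{2n} V_n`   on `t < 0`      (vKP-crit)

with the TYPE-I bound `|V_n(t)| ≤ C/(-t)`, uniformly integrable shells and shells bounded near `0⁻` embeds as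
`W_n(σ) := (e^{-σ} V_n(-e^{-σ})) · e₀`, an admissible eternal solution of `dyadicTable` with covariant viscosity
`ν̂` (`isEternalVisc_dyadic_of_classical`) that is uniformly bounded (`uniformBound_embed_of_typeI`, bound `C`) and
loud on every shell on which `V` is loud (`loud_embed_of_loud`).  With the tree's «loud ⇒ surviving»
(`eternalSurvivingFwd_one_of_loud`) this gives the EQUIVALENCE at each `ε₀ > 0`
(`dyadic_noLoudLadder_iff_classicalTypeI`):

  «(ρ+) on the dyadic member: no uniformly bounded admissible `ν̂ > 0` eternal solution of `dyadicTable` that is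
   loud on every shell `n ≥ 0` is forward (S₁)-surviving»
  ⟺ «for every `ν̂ > 0`, (vKP-crit) has NO type-I solution on `t < 0` with uniformly integrable shells, shells
   bounded near `0⁻`, and every shell `n ≥ 0` loud (`sup_t (1+ε₀)^{-4n} V_n(t)² ≥ ν̂²/4096`)»

— the ancient-solution (Leray-profile) Liouville statement for the viscous dyadic model at base
`Λ = (1+ε₀)^{5/2}`, dissipation degree `α = 2/5`; and BY NAME `classicalTypeI_of_noLoudLadderOne`.  In print only base
`2^{5/2}` is settled (BMR 2011, tree audit of `DyadicCascadeRegularity`).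

HONEST LABEL: dictionary work; the classical statement is OPEN at the route's bases; crux ⟨20419⟩, its children and
every NS statement remain OPEN.
-/

noncomputable section

-- the summit and its single sub-problem share the name (CONVENTIONS §1)
set_option linter.dupNamespace false

namespace Summit.NavierStokesRegularity.NavierStokesRegularity.Theorems.NoSurvivingEternalViscBddOne.WakeCriterion

open Filter Topology Set MeasureTheory
open Literature.Analysis.FluidPDE Literature.Analysis.FluidPDE.TaoCascade
open Summit.NavierStokesRegularity.NavierStokesRegularity.Theses.TaoLadderRungTwoBreak
open Summit.NavierStokesRegularity.NavierStokesRegularity.Theorems.WakeRatchetCritical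
  (integrable_recentre_iff hasDerivAt_sub_exp_neg)
open Summit.NavierStokesRegularity.NavierStokesRegularity.Theorems.WakeRatchetDyadic (dyadic_apply_ne_zero)
open Summit.NavierStokesRegularity.NavierStokesRegularity.Theorems.WakeRatchetDyadicFront (qform_dyadicTable)
open Summit.NavierStokesRegularity.NavierStokesRegularity.Theorems.NoSurvivingEternalViscBddOne
  (eternalSurvivingFwd_one_of_loud)

variable {ε₀ νh : ℝ}

/-- **EMBEDDING with viscosity.**  A real solution of (vKP-crit) on `t < 0` (`ν̂ ≥ 0`) with uniformly integrable
shells and shells bounded near `0⁻` embeds as an admissible eternal solution of `dyadicTable` with covariant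
viscosity `ν̂`: `W_n(σ) := (e^{-σ} V_n(-e^{-σ})) · e₀` (the constant viscosity `ν̂(1+ε₀)^{2n}` of critical time
becomes the covariant `ν̂(1+ε₀)^{2n}e^{-σ}` of log-time).
[cite: Tao2016AveragedNS, §1.2, §4 (the viscous equation before Thm. 4.2), Lemma 4.1 (4.8), §6.4; cell vocabulary (`IsEternalVisc`); tree `integrable_recentre_iff`] -/
theorem isEternalVisc_dyadic_of_classical (hν : 0 ≤ νh) {V : ℤ → ℝ → ℝ}
    (hV : ∀ (n : ℤ) (t : ℝ), t < 0 →
      HasDerivAt (V n) (bigLam ε₀ * V (n - 1) t ^ 2 - (bigLam ε₀)⁻¹ * (V n t * V (n + 1) t)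
        - νh * (1 + ε₀) ^ ((2 : ℝ) * n) * V n t) t)
    (hact : ∃ M : ℝ, ∀ n : ℤ, IntegrableOn (fun t => |V n t|) (Iio 0) ∧ ∫ t in Iio 0, |V n t| ≤ M)
    (hbd : ∀ n : ℤ, ∃ t₀ : ℝ, t₀ < 0 ∧ ∃ P : ℝ, ∀ t : ℝ, t₀ ≤ t → t < 0 → |V n t| ≤ P) :
    IsEternalVisc ε₀ νh dyadicTable
      (fun n σ => (Real.exp (-σ) * V n (-Real.exp (-σ))) • (PiLp.single 2 (0 : Fin 4) (1 : ℝ) : Em 4)) := by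
  set e₀ : Em 4 := (PiLp.single 2 (0 : Fin 4) (1 : ℝ) : Em 4) with he₀
  have he₀j : ∀ j : Fin 4, e₀ j = if j = 0 then 1 else 0 := fun j => by
    rw [he₀, PiLp.single_apply]
  have hne₀ : ‖e₀‖ = 1 := by rw [he₀, PiLp.norm_single, norm_one]
  refine ⟨fun n σ => ?_, hν, ?_, fun n => ?_⟩
  · -- the law
    have hlt : -Real.exp (-σ) < 0 := neg_neg_iff_pos.2 (Real.exp_pos _)
    have h1 : HasDerivAt (fun s : ℝ => Real.exp (-s)) (-Real.exp (-σ)) σ := by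
      have h0 : HasDerivAt (fun s : ℝ => Real.exp (-s)) (Real.exp (-σ) * (-1)) σ :=
        (Real.hasDerivAt_exp (-σ)).comp σ ((hasDerivAt_id σ).neg)
      convert h0 using 1
      ring
    have h2 : HasDerivAt (fun s : ℝ => -Real.exp (-s)) (Real.exp (-σ)) σ := by
      have hf : (fun s : ℝ => -Real.exp (-s)) = fun s => 0 - Real.exp (-s) := by
        funext s; ring
      rw [hf]
      exact hasDerivAt_sub_exp_neg 0 σ
    have hcomp := (hV n _ hlt).scomp σ h2
    have hprod := h1.mul hcomp
    have hvec := hprod.smul_const e₀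
    refine hvec.congr_deriv ?_
    ext j
    simp only [Function.comp_apply, smul_eq_mul, PiLp.smul_apply, PiLp.add_apply, PiLp.neg_apply,
      PiLp.sub_apply, tableQ_apply, tableA_apply, tableB_apply, qform_dyadicTable, he₀j, one_smul]
    by_cases hj : j = 0
    · subst hj
      simp [dyadicTable]
      ring
    · simp [hj]
  · -- the action
    obtain ⟨M, hM⟩ := hact
    refine ⟨M, fun n => ?_⟩
    have h := integrable_recentre_iff (fun t : ℝ => (V n t) • e₀) 0
    have hfun : (fun σ : ℝ => ‖Real.exp (-σ) • (fun t : ℝ => V n t • e₀) (0 - Real.exp (-σ))‖)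
        = fun σ : ℝ => ‖(Real.exp (-σ) * V n (-Real.exp (-σ))) • e₀‖ := by
      funext σ
      rw [zero_sub, smul_smul]
    have hU : (fun t : ℝ => ‖(fun t : ℝ => V n t • e₀) t‖) = fun t : ℝ => |V n t| := by
      funext t
      simp only [norm_smul, Real.norm_eq_abs, hne₀, mul_one]
    rw [hfun, hU] at h
    exact ⟨h.1.2 (hM n).1, by rw [h.2 (hM n).1]; exact (hM n).2⟩
  · -- the forward bound
    obtain ⟨t₀, ht₀, P, hP⟩ := hbd n
    refine ⟨-Real.log (-t₀), P ^ 2, fun σ hσ => ?_⟩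
    have hnt₀ : 0 < -t₀ := neg_pos.2 ht₀
    have hle : t₀ ≤ -Real.exp (-σ) := by
      have h1 : Real.exp (-σ) ≤ Real.exp (Real.log (-t₀)) := Real.exp_le_exp.2 (by linarith)
      rw [Real.exp_log hnt₀] at h1
      linarith
    have hPt := hP _ hle (neg_neg_iff_pos.2 (Real.exp_pos _))
    have hw : Real.exp (2 * σ) * ‖(Real.exp (-σ) * V n (-Real.exp (-σ))) • e₀‖ ^ 2
        = |V n (-Real.exp (-σ))| ^ 2 := by
      rw [norm_smul, hne₀, mul_one, Real.norm_eq_abs, abs_mul, abs_of_pos (Real.exp_pos _), mul_pow,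
        ← mul_assoc, ← Real.exp_nat_mul, ← Real.exp_add]
      have : (2 : ℝ) * σ + ((2 : ℕ) : ℝ) * -σ = 0 := by push_cast; ring
      rw [this, Real.exp_zero, one_mul]
    rw [hw]
    exact pow_le_pow_left₀ (abs_nonneg _) hPt 2

/-- **Type I ⇒ the embedded solution is uniformly bounded** (`‖W_n(σ)‖ = e^{-σ}|V_n(-e^{-σ})| ≤ C`).
[cite: Tao2016AveragedNS, §6.4; cell vocabulary (`UniformBound`)] -/
theorem uniformBound_embed_of_typeI {V : ℤ → ℝ → ℝ} {C : ℝ}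
    (hC : ∀ (n : ℤ) (t : ℝ), t < 0 → |V n t| ≤ C / (-t)) :
    UniformBound
      (fun n σ => (Real.exp (-σ) * V n (-Real.exp (-σ))) • (PiLp.single 2 (0 : Fin 4) (1 : ℝ) : Em 4)) := by
  refine ⟨C, fun n σ => ?_⟩
  have hpos : 0 < Real.exp (-σ) := Real.exp_pos _
  have h := hC n (-Real.exp (-σ)) (neg_neg_iff_pos.2 hpos)
  rw [neg_neg, le_div_iff₀ hpos] at h
  show ‖(Real.exp (-σ) * V n (-Real.exp (-σ))) • (PiLp.single 2 (0 : Fin 4) (1 : ℝ) : Em 4)‖ ≤ C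
  rw [norm_smul, PiLp.norm_single, norm_one, mul_one, Real.norm_eq_abs, abs_mul, abs_of_pos hpos]
  linarith

/-- **Loud in critical time ⇒ loud in log-time** for the embedded solution:
`wtEnergy ε₀ W n σ = physWeight(1)^n V_n(t)²` at `σ = -log(-t)`.
[cite: Tao2016AveragedNS, §4 Thm. 4.2 (statement shape), §6.4; cell vocabulary (`wtEnergy`)] -/
theorem loud_embed_of_loud {V : ℤ → ℝ → ℝ} {n : ℕ} {s₀ : ℝ}
    (h : ∃ t : ℝ, t < 0 ∧ s₀ < physWeight 1 ε₀ ^ n * V n t ^ 2) :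
    ∃ σ : ℝ, s₀ < wtEnergy ε₀
      (fun k σ => (Real.exp (-σ) * V k (-Real.exp (-σ))) • (PiLp.single 2 (0 : Fin 4) (1 : ℝ) : Em 4)) n σ := by
  obtain ⟨t, ht, hs⟩ := h
  have hnt : 0 < -t := neg_pos.2 ht
  refine ⟨-Real.log (-t), ?_⟩
  unfold wtEnergy
  have hkey : Real.exp (2 * -Real.log (-t)) *
      ‖(Real.exp (- -Real.log (-t)) * V (n : ℤ) (-Real.exp (- -Real.log (-t))))
        • (PiLp.single 2 (0 : Fin 4) (1 : ℝ) : Em 4)‖ ^ 2 = V n t ^ 2 := by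
    rw [neg_neg, Real.exp_log hnt, neg_neg, norm_smul, PiLp.norm_single, norm_one, mul_one,
      Real.norm_eq_abs, abs_mul, abs_of_pos hnt, mul_pow, sq_abs, ← mul_assoc,
      show Real.exp (2 * -Real.log (-t)) * (-t) ^ 2 = 1 by
        rw [← Real.exp_log hnt, ← Real.exp_nat_mul, ← Real.exp_add, Real.log_exp]
        have : (2 : ℝ) * -Real.log (-t) + ((2 : ℕ) : ℝ) * Real.log (-t) = 0 := by push_cast; ring
        rw [this, Real.exp_zero], one_mul]
  rw [hkey]
  exact hs

/-- **THE EQUIVALENCE for the viscous dyadic slice (fixed `ε₀ > 0`).**  (ρ+) restricted to `dyadicTable` ⟺ for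
every `ν̂ > 0`, the viscous chain (vKP-crit) has no TYPE-I solution on `t < 0` with uniformly integrable shells,
shells bounded near `0⁻` and every shell `n ≥ 0` loud.  (⇐: `…WakeDyadicViscousClassical`'s dictionary plus type I
from `UniformBound`; ⇒: the embedding, `uniformBound_embed_of_typeI`, `loud_embed_of_loud` and the tree's
«loud ⇒ surviving» `eternalSurvivingFwd_one_of_loud`.)
[cite: Tao2016AveragedNS, §1.2, §4 Thm. 4.2 (statement shape) and the viscous equation before it, §6.4; this file] -/
theorem dyadic_noLoudLadder_iff_classicalTypeI (hε : 0 < ε₀) :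
    (∀ (νh : ℝ) (W : ℤ → ℝ → Em 4), 0 < νh → IsEternalVisc ε₀ νh dyadicTable W → UniformBound W →
      (∀ n₀ : ℕ, ∀ s₀ : ℝ, s₀ < νh ^ 2 / 4096 → ∃ σ : ℝ, s₀ < wtEnergy ε₀ W n₀ σ) →
        ¬ EternalSurvivingFwd 1 ε₀ W) ↔
    (∀ νh : ℝ, 0 < νh → ¬ ∃ V : ℤ → ℝ → ℝ,
      (∀ (n : ℤ) (t : ℝ), t < 0 →
        HasDerivAt (V n) (bigLam ε₀ * V (n - 1) t ^ 2 - (bigLam ε₀)⁻¹ * (V n t * V (n + 1) t)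
          - νh * (1 + ε₀) ^ ((2 : ℝ) * n) * V n t) t) ∧
      (∃ C : ℝ, ∀ (n : ℤ) (t : ℝ), t < 0 → |V n t| ≤ C / (-t)) ∧
      (∃ M : ℝ, ∀ n : ℤ, IntegrableOn (fun t => |V n t|) (Iio 0) ∧ ∫ t in Iio 0, |V n t| ≤ M) ∧
      (∀ n : ℤ, ∃ t₀ : ℝ, t₀ < 0 ∧ ∃ P : ℝ, ∀ t : ℝ, t₀ ≤ t → t < 0 → |V n t| ≤ P) ∧
      (∀ (n : ℕ) (s₀ : ℝ), s₀ < νh ^ 2 / 4096 → ∃ t : ℝ, t < 0 ∧ s₀ < physWeight 1 ε₀ ^ n * V n t ^ 2)) := by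
  constructor
  · -- (ρ+)|dyadic ⇒ classical: embed a would-be loud type-I ancient solution and let «loud ⇒ surviving» clash
    intro hA νh hν ⟨V, hV, ⟨C, hC⟩, hact, hbd, hloud⟩
    have hW := isEternalVisc_dyadic_of_classical (ε₀ := ε₀) hν.le hV hact hbd
    have hU := uniformBound_embed_of_typeI hC
    have hloudW : ∀ n₀ : ℕ, ∀ s₀ : ℝ, s₀ < νh ^ 2 / 4096 → ∃ σ : ℝ, s₀ < wtEnergy ε₀
        (fun k σ => (Real.exp (-σ) * V k (-Real.exp (-σ))) • (PiLp.single 2 (0 : Fin 4) (1 : ℝ) : Em 4))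
          n₀ σ :=
      fun n₀ s₀ hs => loud_embed_of_loud (hloud n₀ s₀ hs)
    exact hA νh _ hν hW hU hloudW (eternalSurvivingFwd_one_of_loud hε hν hU hloudW)
  · -- classical ⇒ (ρ+)|dyadic: the critical variable of a loud bounded solution would be such a V
    intro hB νh W hν hW hU hloud _
    obtain ⟨C, hCW⟩ := hU
    refine hB νh hν ⟨fun n t => (-t)⁻¹ * W n (-Real.log (-t)) 0,
      fun n t ht => dyadic_crit_hasDerivAt_visc hW n ht, ⟨C, fun n t ht => ?_⟩,
      dyadic_crit_action_visc hε hW, fun n => dyadic_crit_bdd_visc hε hW n,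
      fun n s₀ hs => dyadic_crit_loud hε hW (hloud n s₀ hs)⟩
    have hnt : 0 < -t := neg_pos.2 ht
    have h1 : |W n (-Real.log (-t)) 0| ≤ C := by
      rw [← norm_eq_abs_of_support_zero (fun j hj => dyadic_apply_ne_zero hε hW n hj _)]
      exact hCW n _
    rw [abs_mul, abs_of_pos (inv_pos.2 hnt), div_eq_inv_mul]
    exact mul_le_mul_of_nonneg_left h1 (inv_pos.2 hnt).le

/-- **(ρ+) BY NAME ⇒ the viscous classical form below its threshold** (`R = 2`, `inTableClass_dyadicTable`):
`NoLoudLadderOne` forces, for all small `ε₀` and every `ν̂ > 0`, the non-existence of loud type-I ancient solutions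
of (vKP-crit) with uniformly integrable shells and shells bounded near `0⁻`.
[cite: Tao2016AveragedNS, §1.2, §4 Thm. 4.2 (statement shape), §6.4; this file] -/
theorem classicalTypeI_of_noLoudLadderOne (h : NoLoudLadderOne) :
    ∃ εs : ℝ, 0 < εs ∧ ∀ ε₀ : ℝ, 0 < ε₀ → ε₀ ≤ εs → ∀ νh : ℝ, 0 < νh → ¬ ∃ V : ℤ → ℝ → ℝ,
      (∀ (n : ℤ) (t : ℝ), t < 0 →
        HasDerivAt (V n) (bigLam ε₀ * V (n - 1) t ^ 2 - (bigLam ε₀)⁻¹ * (V n t * V (n + 1) t)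
          - νh * (1 + ε₀) ^ ((2 : ℝ) * n) * V n t) t) ∧
      (∃ C : ℝ, ∀ (n : ℤ) (t : ℝ), t < 0 → |V n t| ≤ C / (-t)) ∧
      (∃ M : ℝ, ∀ n : ℤ, IntegrableOn (fun t => |V n t|) (Iio 0) ∧ ∫ t in Iio 0, |V n t| ≤ M) ∧
      (∀ n : ℤ, ∃ t₀ : ℝ, t₀ < 0 ∧ ∃ P : ℝ, ∀ t : ℝ, t₀ ≤ t → t < 0 → |V n t| ≤ P) ∧
      (∀ (n : ℕ) (s₀ : ℝ), s₀ < νh ^ 2 / 4096 → ∃ t : ℝ, t < 0 ∧ s₀ < physWeight 1 ε₀ ^ n * V n t ^ 2) := by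
  obtain ⟨εs, hεs, H⟩ := h 2 (by norm_num)
  refine ⟨εs, hεs, fun ε₀ hε₀ hle => (dyadic_noLoudLadder_iff_classicalTypeI hε₀).1 ?_⟩
  intro νh W hν hW hU hloud
  exact H ε₀ hε₀ hle dyadicTable (inTableClass_dyadicTable le_rfl) νh W hν hW hU hloud

end Summit.NavierStokesRegularity.NavierStokesRegularity.Theorems.NoSurvivingEternalViscBddOne.WakeCriterion

end
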